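import Mathlib
import Summits.NavierStokesRegularity.NavierStokesRegularity.Theorems.EulerZoomLiouvillePowerGaugeEulerLiouvilleFadingTamePast
import HarnessLib.Audit

/-!
# Crux E `PowerGaugeEulerLiouville` (stmt-NavierStokesRegularity-19832): TAME LOG-TIME BREATHERS are trivial
# (line `logtime-breathers`, stub T2b `stub_tameBreather`, filled)

Route `EulerZoomLiouville` (NavierStokesRegularity), crux E.  The LOG-TIME BREATHERS of line `logtime-breathers` (crux dir
`Cruxes/PowerGaugeEulerLiouville/Lines/logtime-breathers.md`, ns-idea-11; the `α = −1` endpoint of Euler's scaling family):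
`u(τ, y) = e^{cτ} V(e^{−cτ} y)` for `τ < 0`.  For `c < 0` they die by the `A`-gauge (`PastShape.ae_eq_zero_of_gauge_of_pastExpandingBreather`).
For `c > 0` and a TAME profile, `‖∇V(z)‖ ≤ C (1 + ‖z‖)^{−(1+ε)}` (`ε > 0`), a CLASSICAL breather member is trivial
(`LogtimeBreather.ae_eq_zero_of_gauge_of_tameBreather` = the line's `Sig.stub_tameBreather` with `IsLogtimeBreather` /
`IsTameProfile` unfolded): such a member has an exponentially fading tame past in the sense of `…FadingTamePast` —
`‖u(τ, y)‖ = e^{cτ}‖V(e^{−cτ}y)‖ ≤ (‖V(0)‖ + C/ε) e^{cτ}` (a tame gradient is integrable along rays, `LogtimeBreather.norm_le_of_tame`)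
and `∇u(τ, y) = ∇V(e^{−cτ} y)` — so `FadingPast.ae_eq_zero_of_gauge_of_fadingTamePast` (backward particle paths of finite length,
null trapped set by incompressibility, pathwise Grönwall with the integrable stretching rate, `PastIrrotational`) applies with `T₁ = 0`.
WHAT THIS IS NOT: not NS regularity, not the crux E — one more classical stratum for the lead skeleton (interim LEAD ns-typeII-p2 g10).
[folklore; line card `Lines/logtime-breathers.md` T2b]
-/

noncomputable section

set_option linter.dupNamespace false

open MeasureTheory Set Filter Topology Metric Function
open scoped NNReal ENNReal ContDiff

namespace Summit.NavierStokesRegularity.NavierStokesRegularity.Theorems.PowerGaugeEulerLiouville.LogtimeBreather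

open Literature.Analysis Literature.Analysis.FluidPDE

/-- **A tame gradient is integrable along rays**: if `V : ℝ³ → ℝ³` is `C¹` with `‖∇V(z)‖ ≤ C (1 + ‖z‖)^{−(1+ε)}` (`ε > 0`), then
`‖V(z)‖ ≤ ‖V(0)‖ + C/ε` for every `z` (`V(z) − V(0) = ∫₀¹ ∇V(sz) z ds` and `∫₀¹ C‖z‖(1 + s‖z‖)^{−(1+ε)} ds = (C/ε)(1 − (1+‖z‖)^{−ε})`).
[folklore] -/
theorem norm_le_of_tame {V : EuclideanSpace ℝ (Fin 3) → EuclideanSpace ℝ (Fin 3)} (hV : ContDiff ℝ 1 V) {C ε : ℝ}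
    (hε : 0 < ε) (htame : ∀ z, ‖fderiv ℝ V z‖ ≤ C * (1 + ‖z‖) ^ (-(1 + ε))) (z : EuclideanSpace ℝ (Fin 3)) :
    ‖V z‖ ≤ ‖V 0‖ + C / ε := by
  have hC0 : 0 ≤ C := by
    have h := htame 0
    rw [norm_zero, add_zero, Real.one_rpow, mul_one] at h
    exact (norm_nonneg _).trans h
  set a : ℝ := ‖z‖ with ha
  have ha0 : 0 ≤ a := norm_nonneg z
  -- the path `g s = V (s • z)` and its derivative
  set g : ℝ → EuclideanSpace ℝ (Fin 3) := fun s => V (s • z) with hg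
  have hVd : Differentiable ℝ V := hV.differentiable one_ne_zero
  have hg' : ∀ s : ℝ, HasDerivAt g (fderiv ℝ V (s • z) z) s := by
    intro s
    have h1 : HasDerivAt (fun s : ℝ => s • z) z s := by
      simpa using (hasDerivAt_id s).smul_const z
    exact (hVd (s • z)).hasFDerivAt.comp_hasDerivAt s h1
  -- the bound `‖g'(s)‖ ≤ N s := C a (1 + s a)^{-(1+ε)}` on `[0, 1]`
  set N : ℝ → ℝ := fun s => C * a * (1 + s * a) ^ (-(1 + ε)) with hN
  have hNc : ContinuousOn N (uIcc 0 1) := by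
    rw [uIcc_of_le zero_le_one]
    refine ContinuousOn.mul continuousOn_const (ContinuousOn.rpow_const (by fun_prop) fun s hs => Or.inl ?_)
    have : 0 ≤ s * a := mul_nonneg hs.1 ha0
    linarith
  have hbound : ∀ s ∈ uIcc (0 : ℝ) 1, ‖fderiv ℝ V (s • z) z‖ ≤ N s := by
    intro s hs
    rw [uIcc_of_le zero_le_one] at hs
    refine (ContinuousLinearMap.le_opNorm _ _).trans ?_
    have h1 := htame (s • z)
    rw [norm_smul, Real.norm_eq_abs, abs_of_nonneg hs.1] at h1
    rw [hN, ← ha]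
    calc ‖fderiv ℝ V (s • z)‖ * a ≤ C * (1 + s * a) ^ (-(1 + ε)) * a := by gcongr
      _ = C * a * (1 + s * a) ^ (-(1 + ε)) := by ring
  have h1 := ODE.norm_sub_le_abs_integral_of_norm_deriv_le_uIcc (g := g) (g' := fun s => fderiv ℝ V (s • z) z)
    (N := N) (t₀ := 0) (t := 1) (fun s _ => (hg' s).hasDerivWithinAt) hNc hbound
  -- `∫₀¹ N = (C/ε) (1 − (1+a)^{-ε}) ≤ C/ε`
  set F : ℝ → ℝ := fun s => -(C / ε) * (1 + s * a) ^ (-ε) with hF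
  have hF' : ∀ s ∈ uIcc (0 : ℝ) 1, HasDerivAt F (N s) s := by
    intro s hs
    rw [uIcc_of_le zero_le_one] at hs
    have hpos : 0 < 1 + s * a := by have : 0 ≤ s * a := mul_nonneg hs.1 ha0; linarith
    have h2 : HasDerivAt (fun s : ℝ => 1 + s * a) a s := by
      simpa using ((hasDerivAt_id s).mul_const a).const_add 1
    have h3 := (h2.rpow_const (p := -ε) (Or.inl hpos.ne')).const_mul (-(C / ε))
    refine h3.congr_deriv ?_
    rw [hN, show -ε - 1 = -(1 + ε) by ring]
    field_simp
  have hint : ∫ s in (0 : ℝ)..1, N s = F 1 - F 0 :=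
    intervalIntegral.integral_eq_sub_of_hasDerivAt hF' (hNc.intervalIntegrable)
  have hF1 : F 1 - F 0 ≤ C / ε := by
    simp only [hF, one_mul, zero_mul, add_zero, Real.one_rpow, mul_one]
    have h2 : 0 ≤ (1 + a) ^ (-ε) := Real.rpow_nonneg (by linarith) _
    have h3 : 0 ≤ C / ε := div_nonneg hC0 hε.le
    nlinarith
  have hint_nn : 0 ≤ ∫ s in (0 : ℝ)..1, N s :=
    intervalIntegral.integral_nonneg zero_le_one fun s hs => by
      rw [hN]
      exact mul_nonneg (mul_nonneg hC0 ha0) (Real.rpow_nonneg (by nlinarith [mul_nonneg hs.1 ha0]) _)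
  have hg1 : g 1 = V z := by simp [hg]
  have hg0 : g 0 = V 0 := by simp [hg]
  rw [hg1, hg0, abs_of_nonneg hint_nn, hint] at h1
  have h4 := norm_sub_norm_le (V z) (V 0)
  linarith

variable {u : ℝ → EuclideanSpace ℝ (Fin 3) → EuclideanSpace ℝ (Fin 3)} {p : ℝ → EuclideanSpace ℝ (Fin 3) → ℝ}

/-- **TAME LOG-TIME BREATHERS ARE TRIVIAL** (line `logtime-breathers`, stub T2b `stub_tameBreather`, binders unfolded).  Crux
hypotheses verbatim (`0 < ρ ≤ ½`) + `(u, p)` classical on the past + `u(τ, y) = e^{cτ} V(e^{−cτ} y)` for all `τ < 0` with `c > 0`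
+ `‖∇V(z)‖ ≤ C(1 + ‖z‖)^{−(1+ε)}` (`ε > 0`) ⇒ `u = 0` a.e. on `(−∞, 0) × ℝ³`: the member has an exponentially fading tame past
(`‖u(τ,·)‖ ≤ (‖V 0‖ + C/ε) e^{cτ}`, `∇u(τ, y) = ∇V(e^{−cτ} y)`), so `FadingPast.ae_eq_zero_of_gauge_of_fadingTamePast` applies with
`T₁ = 0`. [folklore; line card `Lines/logtime-breathers.md` T2b] -/
theorem ae_eq_zero_of_gauge_of_tameBreather {ρ : ℝ} (hρ : 0 < ρ) (hρh : ρ ≤ 1 / 2)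
    {H : ℝ → EuclideanSpace ℝ (Fin 3) → EuclideanSpace ℝ (Fin 3) →L[ℝ] EuclideanSpace ℝ (Fin 3)} {c₀ : ℝ≥0}
    (hsw : IsSuitableWeakSolutionOn (slab (EuclideanSpace ℝ (Fin 3)) (Iio 0) isOpen_Iio) 0 0 u p)
    (hH : HasWeakSpatialGradientOn (slab (EuclideanSpace ℝ (Fin 3)) (Iio 0) isOpen_Iio) u H)
    (hgauge : ∀ a : ℝ, 0 < a →
      ENNReal.ofReal (a ^ (2 * ρ)) * cknA a (0 : ℝ × EuclideanSpace ℝ (Fin 3)) u +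
          ENNReal.ofReal (a ^ ρ) * cknE a (0 : ℝ × EuclideanSpace ℝ (Fin 3)) H +
        ENNReal.ofReal (a ^ (2 * ρ)) * cknD a (0 : ℝ × EuclideanSpace ℝ (Fin 3)) p ≤ (c₀ : ℝ≥0∞))
    (hcl : IsClassicalEulerSolutionOn (Iio 0) 0 u p) {c : ℝ} {V : EuclideanSpace ℝ (Fin 3) → EuclideanSpace ℝ (Fin 3)}
    (hc : 0 < c) (hbr : c ≠ 0 ∧ ∀ τ : ℝ, τ < 0 → ∀ y, u τ y = Real.exp (c * τ) • V (Real.exp (-(c * τ)) • y))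
    (htame : ∃ C ε : ℝ, 0 < ε ∧ ∀ z, ‖fderiv ℝ V z‖ ≤ C * (1 + ‖z‖) ^ (-(1 + ε))) :
    uncurry u =ᵐ[volume.restrict (Iio (0 : ℝ) ×ˢ (univ : Set (EuclideanSpace ℝ (Fin 3))))] 0 := by
  obtain ⟨C, ε, hε, htame⟩ := htame
  obtain ⟨-, hbr⟩ := hbr
  -- the profile is smooth: `V z = e^{c} u(−1, e^{−c} z)`
  have hVrep : V = fun z => Real.exp c • u (-1) (Real.exp (-c) • z) := by
    funext z
    have h := hbr (-1) (by norm_num) (Real.exp (-c) • z)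
    rw [mul_neg_one, neg_neg, smul_smul, ← Real.exp_add, add_neg_cancel, Real.exp_zero, one_smul] at h
    rw [h, smul_smul, ← Real.exp_add, add_neg_cancel, Real.exp_zero, one_smul]
  have hV : ContDiff ℝ 1 V := by
    rw [hVrep]
    have h1 : ContDiff ℝ 1 (u (-1)) := (hcl.contDiff_velocity (by norm_num : (-1 : ℝ) < 0)).of_le (by exact_mod_cast le_top)
    exact (h1.comp (contDiff_const_smul _)).const_smul _
  have hVd : Differentiable ℝ V := hV.differentiable one_ne_zero
  set MV : ℝ := ‖V 0‖ + C / ε with hMV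
  have hVb : ∀ z, ‖V z‖ ≤ MV := norm_le_of_tame hV hε htame
  -- (H1) exponentially fading velocity
  have hvel : ∀ s : ℝ, s < 0 → ∀ y, ‖u s y‖ ≤ MV * Real.exp (c * s) := by
    intro s hs y
    rw [hbr s hs y, norm_smul, Real.norm_eq_abs, abs_of_pos (Real.exp_pos _), mul_comm]
    exact mul_le_mul_of_nonneg_right (hVb _) (Real.exp_pos _).le
  -- (H2) the gradient in the breathing variable
  have hgrad : ∀ s : ℝ, s < 0 → ∀ y, ‖fderiv ℝ (u s) y‖ ≤ C * (1 + Real.exp (-(c * s)) * ‖y‖) ^ (-(1 + ε)) := by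
    intro s hs y
    have hus : u s = fun y => Real.exp (c * s) • V (Real.exp (-(c * s)) • y) := funext (hbr s hs)
    have hder : HasFDerivAt (u s) (fderiv ℝ V (Real.exp (-(c * s)) • y)) y := by
      rw [hus]
      have h1 : HasFDerivAt (fun y : EuclideanSpace ℝ (Fin 3) => Real.exp (-(c * s)) • y)
          (Real.exp (-(c * s)) • ContinuousLinearMap.id ℝ (EuclideanSpace ℝ (Fin 3))) y :=
        (ContinuousLinearMap.id ℝ (EuclideanSpace ℝ (Fin 3))).hasFDerivAt.const_smul (Real.exp (-(c * s)))
      have h2 := ((hVd (Real.exp (-(c * s)) • y)).hasFDerivAt.comp y h1).const_smul (Real.exp (c * s))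
      refine h2.congr_fderiv ?_
      ext v
      simp only [FunLike.coe_smul, Pi.smul_apply, ContinuousLinearMap.comp_apply, ContinuousLinearMap.id_apply,
        map_smul, smul_smul, ← Real.exp_add, add_neg_cancel, Real.exp_zero, one_smul]
    rw [hder.fderiv]
    have h := htame (Real.exp (-(c * s)) • y)
    rwa [norm_smul, Real.norm_eq_abs, abs_of_pos (Real.exp_pos _)] at h
  exact FadingPast.ae_eq_zero_of_gauge_of_fadingTamePast hρ hρh hsw hH hgauge le_rfl hcl hc hε hvel hgrad

end Summit.NavierStokesRegularity.NavierStokesRegularity.Theorems.PowerGaugeEulerLiouville.LogtimeBreather
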